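import Literature.NumberTheory.Automorphic.AshSmithTheoryHeckeTrivialCharacterProofs
import Mathlib.RingTheory.Polynomial.Vieta
import Mathlib.Algebra.Polynomial.Expand
import HarnessLib

/-!
# Ash (2003), *Smith theory and Hecke operators* — proofs towards the named fact
# `Ash2003_inducedRayClassCharacter_attached`: the explicit eigencharacter `χ_θ` (Thm. 4.3) has
# `ρ_θ = Ind θ` attached (Lemma 4.2)

Topic `NumberTheory/Automorphic`; companion of `Literature.NumberTheory.Automorphic.AshSmithTheoryHecke`
(the named fact `Ash2003_inducedRayClassCharacter_attached` = A. Ash, *Smith theory and Hecke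
operators*, J. Algebra **259** (2003) 43–58 [Ash2003], Thm. 1.1 / Cor. 4.4).  The eigenclass that
[Ash2003] produces by Smith theory has the EXPLICIT eigencharacter
`χ_θ(T_{l,k}) = ∑_Q θ([λ_Q])`, the sum over the `k/d`-element sets `Q` of primes of `L = ℚ(ζ_p)` above
`l` (`d` their common residue degree; `λ_Q = ∏_{w ∈ Q} w`), i.e. the `(k/d)`-th elementary symmetric
function of the values `θ([w])`, `w ∣ l`, and `0` when `d ∤ k` ([Ash2003, Thm. 4.3]); [Ash2003,
Lemma 4.2] says that this `χ_θ` has `ρ_θ = Ind θ` attached.  The Galois half of the fact in the tree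
(`Ash2003.exists_isAttached_induce_of_isGaloisAvatar`, `AshSmithTheoryHeckeAttachedProofs`) only
exhibited SOME attached eigenvalue system (read off the coefficients of the Frobenius polynomial);
this file proves the explicit form:

* `Ash2003.isAttached_induce_esymm`: `Ind ϑ` is attached (`Ash2003.IsAttached`) to the system
  `a(l,k) = e_{k/d}((θ([w]))_{w ∣ l})` for `d ∣ k` (`d = ord_p(l)`), `a(l,k) = 0` for `d ∤ k`.

The content is the polynomial identity `heckeFrobPoly_esymm_eq_prod` (pure algebra):
for `c₁,…,c_g` in a commutative ring, `d g = n`, and `q` with `q^d = 1` and `q^{d/2} = -1` if `d` is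
even (as holds for `q = l` in characteristic `p`, `d = ord_p(l)`),
`∑_{k ≤ n} (-1)^k q^{k(k-1)/2} a_k X^{n-k} = ∏_i (X^d - c_i)` with `a_{dj} = e_j(c)`, `a_k = 0`
otherwise — Vieta (`Multiset.prod_X_sub_X_eq_sum_esymm`) after `X ↦ X^d` (`Polynomial.expand`), the
signs and powers of `q` cancelling by `(-1)^{dj} q^{dj(dj-1)/2} = (-1)^j`
(`neg_one_pow_mul_pow_eq_neg_one_pow`).  Also `coeff_heckeFrobPoly` / `heckeFrobPoly_injOn`: an
attached eigenvalue system is determined on `k ≤ n` by its Frobenius polynomials when `q` is a unit.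

## References

* A. Ash, *Smith theory and Hecke operators*, J. Algebra 259 (2003) 43–58, Lemma 4.2, Thm. 4.3,
  Thm. 6.2 [Ash2003].
-/

noncomputable section

open scoped NumberField
open IsDedekindDomain Polynomial

namespace Literature.NumberTheory.Automorphic

/-! ### Coefficients of the Hecke–Frobenius polynomial -/

section Coeff

variable {A : Type*} [CommRing A]

/-- The coefficient of `X^{n-k}` in `heckeFrobPoly q n a` is `(-1)^k q^{k(k-1)/2} a_k` (`k ≤ n`).
[folklore] -/
theorem coeff_heckeFrobPoly (q n : ℕ) (a : ℕ → A) {k : ℕ} (hk : k ≤ n) :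
    (heckeFrobPoly q n a).coeff (n - k) = (-1) ^ k * (q : A) ^ (k * (k - 1) / 2) * a k := by
  unfold heckeFrobPoly
  rw [Polynomial.finsetSum_coeff, Finset.sum_eq_single k]
  · rw [Polynomial.coeff_C_mul, Polynomial.coeff_X_pow, if_pos rfl, mul_one]
  · intro i hi hik
    rw [Finset.mem_range, Nat.lt_succ_iff] at hi
    rw [Polynomial.coeff_C_mul, Polynomial.coeff_X_pow, if_neg (by omega), mul_zero]
  · intro h
    exact absurd (Finset.mem_range.2 (Nat.lt_succ_of_le hk)) h

/-- **An eigenvalue system is determined by its Hecke–Frobenius polynomial** on `k ≤ n` when `q` is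
a unit of the coefficient ring (e.g. `q = l ∤ p` in characteristic `p`). [folklore] -/
theorem heckeFrobPoly_injOn {q n : ℕ} (hq : IsUnit (q : A)) {a b : ℕ → A}
    (h : heckeFrobPoly q n a = heckeFrobPoly q n b) {k : ℕ} (hk : k ≤ n) : a k = b k := by
  have h1 := congrArg (fun P : A[X] => P.coeff (n - k)) h
  simp only [coeff_heckeFrobPoly q n _ hk] at h1
  have hu : IsUnit ((-1 : A) ^ k * (q : A) ^ (k * (k - 1) / 2)) :=
    ((isUnit_one.neg).pow k).mul (hq.pow _)
  exact hu.mul_left_cancel h1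

end Coeff

/-! ### The identity `∑ (-1)^k q^{k(k-1)/2} e_{k/d}(c) X^{n-k} = ∏ (X^d - c_i)` -/

section Esymm

variable {A : Type*} [CommRing A]

/-- `(-1)^{dj} q^{dj(dj-1)/2} = (-1)^j` when `q^d = 1` and, for even `d`, `q^{d/2} = -1`. [folklore] -/
theorem neg_one_pow_mul_pow_eq_neg_one_pow {q : A} {d : ℕ} (hd : 0 < d) (hq1 : q ^ d = 1)
    (hq2 : Even d → q ^ (d / 2) = -1) (j : ℕ) :
    (-1 : A) ^ (d * j) * q ^ (d * j * (d * j - 1) / 2) = (-1) ^ j := by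
  rcases Nat.even_or_odd d with hev | hodd
  · -- `d = e + e`
    obtain ⟨e, rfl⟩ := hev
    have he : 0 < e := by omega
    have h2 : (e + e) / 2 = e := by omega
    rw [h2] at hq2
    have hexp : (e + e) * j * ((e + e) * j - 1) / 2 = e * (j * ((e + e) * j - 1)) := by
      have h3 : (e + e) * j * ((e + e) * j - 1) = 2 * (e * (j * ((e + e) * j - 1))) := by ring
      rw [h3, Nat.mul_div_cancel_left _ (by norm_num : 0 < 2)]
    have hsign : (-1 : A) ^ ((e + e) * j) = 1 := by
      rw [show (e + e) * j = 2 * (e * j) by ring, pow_mul, neg_one_sq, one_pow]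
    rw [hexp, pow_mul q e, hq2 ⟨e, rfl⟩, hsign, one_mul]
    -- the parity of `j ((e+e) j - 1)` is that of `j`
    rcases Nat.even_or_odd j with hj | hj
    · rw [hj.neg_one_pow, (hj.mul_right _).neg_one_pow]
    · have hodd' : Odd (j * ((e + e) * j - 1)) := by
        refine hj.mul (Nat.Even.sub_odd ?_ ⟨e * j, by ring⟩ odd_one)
        obtain ⟨m, rfl⟩ := hj
        nlinarith
      rw [hj.neg_one_pow, hodd'.neg_one_pow]
  · -- `d` odd: the exponent of `q` is a multiple of `d`
    have hsign : (-1 : A) ^ (d * j) = (-1) ^ j := by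
      rw [pow_mul, hodd.neg_one_pow]
    have hdiv : 2 ∣ j * (d * j - 1) := by
      rcases Nat.even_or_odd j with hj | hj
      · exact (hj.mul_right _).two_dvd
      · have hdj : Odd (d * j) := hodd.mul hj
        have h1 : 1 ≤ d * j := Nat.one_le_iff_ne_zero.2 fun h => by
          rw [h] at hdj
          exact (Nat.not_odd_zero hdj)
        exact ((Nat.Odd.sub_odd hdj odd_one).mul_left _).two_dvd
    have hexp : d * j * (d * j - 1) / 2 = d * (j * (d * j - 1) / 2) := by
      rw [mul_assoc, Nat.mul_div_assoc _ hdiv]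
    rw [hexp, pow_mul q d, hq1, one_pow, mul_one, hsign]

/-- **`∑_{k ≤ n} (-1)^k q^{k(k-1)/2} a_k X^{n-k} = ∏_i (X^d - c_i)` for `a_{dj} = e_j(c)`, `a_k = 0` if
`d ∤ k`** (`n = d g`, `g = #c`), whenever `q^d = 1` and `q^{d/2} = -1` for even `d` (e.g. `q = l` of
exact multiplicative order `d` modulo the odd prime `p = char A`): Vieta's formula
(Mathlib `Multiset.prod_X_sub_X_eq_sum_esymm`) pushed along `X ↦ X^d` (`Polynomial.expand`), the
signs and the powers of `q` cancelling (`neg_one_pow_mul_pow_eq_neg_one_pow`).  This is the algebra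
of [Ash2003, Lemma 4.2 / Thm. 4.3]: the eigencharacter `χ_θ(T_{l,k}) = ∑_Q θ([λ_Q])` has
`∏_{w ∣ l} (X^d - θ([w])) = det(X - Ind θ(Frob_l))` as its Hecke–Frobenius polynomial. [folklore] -/
theorem heckeFrobPoly_esymm_eq_prod {q d g : ℕ} (hd : 0 < d) (hq1 : (q : A) ^ d = 1)
    (hq2 : Even d → (q : A) ^ (d / 2) = -1) (c : Multiset A) (hc : Multiset.card c = g) :
    heckeFrobPoly q (d * g) (fun k => if d ∣ k then c.esymm (k / d) else 0) =
      (c.map fun t => X ^ d - C t).prod := by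
  classical
  -- Vieta after `X ↦ X^d`
  have hR : (c.map fun t => X ^ d - C t).prod =
      ∑ j ∈ Finset.range (g + 1), (-1) ^ j * (C (c.esymm j) * X ^ (d * (g - j))) := by
    have hV := congrArg (Polynomial.expand A d) (Multiset.prod_X_sub_X_eq_sum_esymm c)
    rw [map_multiset_prod, Multiset.map_map, map_sum, hc] at hV
    have hL : (c.map ((Polynomial.expand A d) ∘ fun t => X - C t)).prod =
        (c.map fun t => X ^ d - C t).prod := by
      congr 1
      refine Multiset.map_congr rfl fun t _ => ?_
      rw [Function.comp_apply, map_sub, Polynomial.expand_X, Polynomial.expand_C]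
    rw [hL] at hV
    rw [hV]
    refine Finset.sum_congr rfl fun j _ => ?_
    rw [map_mul, map_pow, map_neg, map_one, map_mul, Polynomial.expand_C, map_pow,
      Polynomial.expand_X, ← pow_mul]
  rw [hR]
  unfold heckeFrobPoly
  -- kill the terms with `d ∤ k`
  have hterm : ∀ k ∈ Finset.range (d * g + 1),
      C ((-1 : A) ^ k * (q : A) ^ (k * (k - 1) / 2) *
          (fun k => if d ∣ k then c.esymm (k / d) else 0) k) * X ^ (d * g - k) =
        if d ∣ k then C ((-1 : A) ^ k * (q : A) ^ (k * (k - 1) / 2) * c.esymm (k / d)) *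
          X ^ (d * g - k) else 0 := by
    intro k _
    beta_reduce
    split_ifs <;> simp
  rw [Finset.sum_congr rfl hterm, ← Finset.sum_filter]
  -- reindex `k = d j`
  have hfilter : (Finset.range (d * g + 1)).filter (fun k => d ∣ k) =
      (Finset.range (g + 1)).map ⟨fun j => d * j, mul_right_injective₀ hd.ne'⟩ := by
    ext k
    simp only [Finset.mem_filter, Finset.mem_range, Finset.mem_map, Function.Embedding.coeFn_mk]
    constructor
    · rintro ⟨hk, j, rfl⟩
      exact ⟨j, Nat.lt_succ_of_le (Nat.le_of_mul_le_mul_left (Nat.lt_succ_iff.1 hk) hd), rfl⟩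
    · rintro ⟨j, hj, rfl⟩
      exact ⟨Nat.lt_succ_of_le (Nat.mul_le_mul_left d (Nat.lt_succ_iff.1 hj)), j, rfl⟩
  rw [hfilter, Finset.sum_map]
  refine Finset.sum_congr rfl fun j _ => ?_
  simp only [Function.Embedding.coeFn_mk]
  rw [Nat.mul_div_cancel_left j hd, ← mul_tsub, neg_one_pow_mul_pow_eq_neg_one_pow hd hq1 hq2 j,
    map_mul, map_pow, map_neg, map_one, mul_assoc]

end Esymm


/-! ### [Ash2003, Lemma 4.2]: the explicit eigencharacter `χ_θ` has `Ind θ` attached -/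

namespace Ash2003

open GaloisRepresentations

open scoped Classical in
/-- **[Ash2003, Lemma 4.2 with Thm. 4.3]: the eigencharacter `χ_θ` has `ρ_θ = Ind θ` attached.**
For a prime `p`, `N ≥ 1`, a field `F` of characteristic `p`, a character `θ` of `Cl^{(pN)}(ℚ(ζ_p))` and
a Galois avatar `ϑ` of `θ`, the representation `Ind_{Γ_{ℚ(ζ_p)}}^{Γ_ℚ} ϑ` is attached
(`Ash2003.IsAttached`) to the EXPLICIT system of eigenvalues
`χ_θ(l, k) = e_{k/d}((θ([w]))_{w ∣ l})` if `d ∣ k` and `0` otherwise, where `d = ord_p(l)` is the common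
residue degree of the (finitely many, `finite_heightOneSpectrum_under_eq`) primes `w` of `ℚ(ζ_p)`
above `l` and `e_j` the `j`-th elementary symmetric function (`Multiset.esymm`; `θ([w])` is read as
`0` at the primes `w` not coprime to `(pN)`, which do not occur above `l ∤ p·pN`) — Ash's
`χ_θ(T_{l,k}) = ∑_Q θ([λ_Q])`, the sum over the `(k/d)`-subsets `Q` of the primes above `l`,
`λ_Q = ∏_{w ∈ Q} w` ([Ash2003, Thm. 4.3, Thm. 6.2]).  Proof:
`det(X - Ind ϑ(Frob_l)) = ∏_{w ∣ l} (X^d - θ([w]))` (`hasFrobCharpolyAt_induce_of_isGaloisAvatar`,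
`inertiaDeg_eq_orderOf`) and `heckeFrobPoly_esymm_eq_prod` with `l^d = 1`, `l^{d/2} = -1` (`d` even)
in characteristic `p`. [cite: Ash2003, Lemma 4.2 and Thm. 4.3] -/
theorem isAttached_induce_esymm (p : ℕ) [hp : Fact p.Prime] {N : ℕ} (hN : N ≠ 0) {F : Type*}
    [Field F] [Algebra (ZMod p) F] [TopologicalSpace F]
    (θ : RayClassGroup (modulus (CyclotomicField p ℚ) (p * N)) →* Fˣ)
    (ϑ : FramedGaloisRep (CyclotomicField p ℚ) F 1)
    (hϑ : IsGaloisAvatar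
      (modulus_ne_bot (CyclotomicField p ℚ) (mul_ne_zero (Nat.Prime.ne_zero hp.out) hN)) θ ϑ) :
    IsAttached p (p * N) (FramedGaloisRep.induce ℚ (finrank_cyclotomicField p) ϑ) fun v k =>
      if orderOf (v.residueCard : ZMod p) ∣ k then
        (((Set.finite_coe_iff.1 (finite_heightOneSpectrum_under_eq (M := CyclotomicField p ℚ) v)
            ).toFinset.val.map fun w : HeightOneSpectrum (𝓞 (CyclotomicField p ℚ)) =>
              if hw : IsCoprime w.asIdeal (modulus (CyclotomicField p ℚ) (p * N)) then
                ((θ (integralRayClass (modulus (CyclotomicField p ℚ) (p * N))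
                  (modulus_ne_bot (CyclotomicField p ℚ) (mul_ne_zero (Nat.Prime.ne_zero hp.out) hN))
                  ⟨w.asIdeal, w.ne_bot, hw⟩) : Fˣ) : F)
              else 0).esymm
          (k / orderOf (v.residueCard : ZMod p)))
      else 0 := by
  intro v hv
  refine ⟨isUnramifiedAt_induce_of_isGaloisAvatar p hN θ ϑ hϑ hv, ?_⟩
  have hP := hasFrobCharpolyAt_induce_of_isGaloisAvatar p hN θ ϑ hϑ hv
  have hpv : ¬ v.residueCard ∣ p := fun h' => hv (h'.trans (Dvd.intro _ rfl))
  have hpl : ¬ p ∣ v.residueCard := not_dvd_residueCard p hv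
  -- the finite set of places above `v` and the values `θ([w])`
  have hs : Set.Finite {w : HeightOneSpectrum (𝓞 (CyclotomicField p ℚ)) | w.under (𝓞 ℚ) = v} :=
    Set.finite_coe_iff.1 (finite_heightOneSpectrum_under_eq (M := CyclotomicField p ℚ) v)
  set θv : HeightOneSpectrum (𝓞 (CyclotomicField p ℚ)) → F := fun w =>
    if hw : IsCoprime w.asIdeal (modulus (CyclotomicField p ℚ) (p * N)) then
      ((θ (integralRayClass (modulus (CyclotomicField p ℚ) (p * N))
        (modulus_ne_bot (CyclotomicField p ℚ) (mul_ne_zero (Nat.Prime.ne_zero hp.out) hN))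
        ⟨w.asIdeal, w.ne_bot, hw⟩) : Fˣ) : F)
    else 0 with hθv
  -- the order `d` of `l` mod `p`: `l^d = 1` and `l^{d/2} = -1` for even `d`, in `F`
  have hu0 : (v.residueCard : ZMod p) ≠ 0 := by
    rw [Ne, ZMod.natCast_eq_zero_iff]
    exact hpl
  have hfin : IsOfFinOrder (v.residueCard : ZMod p) :=
    isOfFinOrder_iff_pow_eq_one.mpr ⟨p - 1, by have := hp.out.one_lt; omega,
      ZMod.pow_card_sub_one_eq_one hu0⟩
  have hd0 : 0 < orderOf (v.residueCard : ZMod p) := hfin.orderOf_pos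
  have hcast : ((v.residueCard : ℕ) : F) = algebraMap (ZMod p) F (v.residueCard : ZMod p) := by
    rw [map_natCast]
  have hq1 : ((v.residueCard : ℕ) : F) ^ orderOf (v.residueCard : ZMod p) = 1 := by
    rw [hcast, ← map_pow, pow_orderOf_eq_one, map_one]
  have hq2 : Even (orderOf (v.residueCard : ZMod p)) →
      ((v.residueCard : ℕ) : F) ^ (orderOf (v.residueCard : ZMod p) / 2) = -1 := fun hev => by
    have hx : (v.residueCard : ZMod p) ^ (orderOf (v.residueCard : ZMod p) / 2) = -1 := by
      have hsq : (v.residueCard : ZMod p) ^ (orderOf (v.residueCard : ZMod p) / 2) *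
          (v.residueCard : ZMod p) ^ (orderOf (v.residueCard : ZMod p) / 2) = 1 := by
        rw [← pow_add, ← two_mul, Nat.mul_div_cancel' hev.two_dvd, pow_orderOf_eq_one]
      rcases mul_self_eq_one_iff.1 hsq with h1 | h1
      · exact absurd h1 (pow_ne_one_of_lt_orderOf
          (Nat.div_pos (Nat.le_of_dvd hd0 hev.two_dvd) two_pos).ne' (Nat.div_lt_self hd0 one_lt_two))
      · exact h1
    rw [hcast, ← map_pow, hx, map_neg, map_one]
  -- the multiset of the `θ([w])`, `w ∣ v`, has `g = #{w ∣ v}` elements with `d g = p - 1`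
  set c : Multiset F := hs.toFinset.val.map θv with hc
  have hmem : ∀ w, w ∈ hs.toFinset ↔ w.under (𝓞 ℚ) = v := fun w => by
    rw [Set.Finite.mem_toFinset]
    rfl
  have hcard : Multiset.card c =
      Nat.card {w : HeightOneSpectrum (𝓞 (CyclotomicField p ℚ)) // w.under (𝓞 ℚ) = v} := by
    rw [hc, Multiset.card_map, Finset.card_val]
    change hs.toFinset.card =
      Nat.card {w : HeightOneSpectrum (𝓞 (CyclotomicField p ℚ)) | w.under (𝓞 ℚ) = v}
    rw [Nat.card_coe_set_eq, Set.ncard_eq_toFinset_card _ hs]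
  have hdg : orderOf (v.residueCard : ZMod p) *
      Nat.card {w : HeightOneSpectrum (𝓞 (CyclotomicField p ℚ)) // w.under (𝓞 ℚ) = v} = p - 1 := by
    rw [mul_comm]
    exact card_placesOver_mul_orderOf p hpv
  -- the Hecke–Frobenius polynomial of the system at `v` is `∏_{w ∣ v} (X^d - θ([w]))`
  have e : heckeFrobPoly v.residueCard ((p - 1) * 1)
      (fun k => if orderOf (v.residueCard : ZMod p) ∣ k then
        c.esymm (k / orderOf (v.residueCard : ZMod p)) else 0) =
      (c.map fun t => X ^ orderOf (v.residueCard : ZMod p) - C t).prod := by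
    rw [mul_one, ← hdg]
    exact heckeFrobPoly_esymm_eq_prod hd0 hq1 hq2 c hcard
  -- compare with the Frobenius polynomial of `Ind ϑ`
  have hprod : (∏ᶠ w : {w : HeightOneSpectrum (𝓞 (CyclotomicField p ℚ)) // w.under (𝓞 ℚ) = v},
      (X ^ (w.1.asIdeal.inertiaDeg (𝓞 ℚ)) -
        C ((θ (integralRayClass (modulus (CyclotomicField p ℚ) (p * N))
          (modulus_ne_bot (CyclotomicField p ℚ) (mul_ne_zero (Nat.Prime.ne_zero hp.out) hN))
          ⟨w.1.asIdeal, w.1.ne_bot, isCoprime_modulus_of_under_eq p hv w.2⟩) : Fˣ) : F))) =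
      (c.map fun t => X ^ orderOf (v.residueCard : ZMod p) - C t).prod := by
    rw [@finprod_eq_prod_of_fintype _ _ _ (@Fintype.ofFinite _ (finite_heightOneSpectrum_under_eq v)),
      hc, Multiset.map_map, ← Finset.prod_eq_multiset_prod,
      @Finset.prod_subtype _ _ _ (fun x : HeightOneSpectrum (𝓞 (CyclotomicField p ℚ)) =>
          x.under (𝓞 ℚ) = v)
        (@Fintype.ofFinite _ (finite_heightOneSpectrum_under_eq v)) hs.toFinset hmem
        ((fun t => X ^ orderOf (v.residueCard : ZMod p) - C t) ∘ θv)]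
    refine Finset.prod_congr rfl fun w _ => ?_
    rw [Function.comp_apply, inertiaDeg_eq_orderOf p hpv (congrArg HeightOneSpectrum.asIdeal w.2),
      hθv]
    beta_reduce
    rw [dif_pos (isCoprime_modulus_of_under_eq p hv w.2)]
  rw [← hprod] at e
  -- the eigenvalue system of the statement, at `v`, is the one of `e` (definitionally)
  convert hP using 2
  exact e

end Ash2003

end Literature.NumberTheory.Automorphic
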